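import Literature.NumberTheory.Automorphic.HeckeDoubleCosetOperators
import HarnessLib

/-!
# R90 · S6 «Ch. 14.1–14.5 stable trace formula» — WAVE 7 card W7-a.1: the coefficient function of `T ∈ ℋ(G, K)`
# is constant on `K`-orbits of `G ⧸ K` (`Theorems/R90S6HeckeCoeffOrbit.lean`)

Cell `hodgecm-mathlib`, crux H413 (`stmt-HodgeConjecture-24833`), route of record `HCCMUnconditional`; programme R90-TF,
section S6 (base `R90-C14`), seat R90-C14-p06 (g0); S6 WAVE 7 (R90-C14-plan (g2), R90 bus 2026-09-04T23:08:14Z ∕ 23:10:40Z ∕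
23:14:13Z), card W7-a.1 of the typist's sheet `R90/R90-C14-typ1/g2/S6_wave7_targets.v1.712f4079a2a1dc1c.lean` :68–:71
(signature token-identical; namespace segment `.Wave7` dropped, as for W3∕W6).  Helper lane
`--supports stmt-HodgeConjecture-24833 --as helper`; THEOREMS ONLY (no definition, no instance, no notation, no named fact,
no `sorry`); imports = ★ `Literature.NumberTheory.Automorphic.HeckeDoubleCosetOperators` + HarnessLib (no Lines import).

CONTENT (pure group theory, generic coefficient ring `k`).  For `T ∈ ℋ(G, K) = End_G(k[G ⧸ K])` the vector
`T [K] = heckeAlgebra.toVector K T ∈ k[G ⧸ K]` is `K`-invariant (★ `heckeAlgebra.ofMulAction_toVector`), hence its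
coefficients are constant along `K`-orbits of `G ⧸ K` (★ `heckeAlgebra.coeff_eq_of_mem_orbit`): the function
`g ↦ (T [K])(gK)` (S6 D's `heckeToFun K T`, `Cruxes/H413/Lines/R90_S6_FloorE1D.lean` :219–:220) is bi-`K`-invariant.
This is the first of the four «eG-independence» lemmas (W7-a.1…a.4) by which the E1.3.9 assembly fixes ONE transport
`eG : U(H′)(L⁺_v) ≃ₜ* U(J₀,3)(L_w)`.

* **`coeff_toVector_eq_of_mem_orbit`** — W7-a.1.

HONEST LABEL: a helper theorem, count-neutral until the E1.3.9 assembly consumes W7-a.4; HC_CM is proved only modulo the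
7 printed citations (2 remaining named inputs: hLiu418 = stmt-HodgeConjecture-24832, h413 = stmt-HodgeConjecture-24833)
until rung 0 closes; REL ≠ ★ ≠ BUILT.

## References
* [CartierCorvallis1979] P. Cartier, *Representations of 𝔭-adic groups: a survey*, PSPM 33.1 (1979), §I.3–I.4, §IV.1.
* [ShimuraIATAF1971] G. Shimura, *Introduction to the arithmetic theory of automorphic functions* (1971), §3.1.
-/

set_option autoImplicit false
-- the mandated namespace repeats the single-problem summit's segment (`HodgeConjecture.HodgeConjecture`)
set_option linter.dupNamespace false

noncomputable section

open MulAction MonoidAlgebra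
open Literature.NumberTheory.Automorphic

namespace Summit.HodgeConjecture.HodgeConjecture.R90.S6

variable {k : Type*} [CommRing k]

/-- **W7-a.1** `coeff_toVector_eq_of_mem_orbit`: for `T ∈ ℋ(G, K) = End_G(k[G ⧸ K])` the vector `T [K]` is `K`-fixed
(★ `heckeAlgebra.ofMulAction_toVector`), hence its coefficient at `yK` equals its coefficient at `xK` whenever `yK ∈ K · xK`,
i.e. `g ↦ (T [K])(gK)` (S6 D's `heckeToFun K T`) is bi-`K`-invariant. [cite: CartierCorvallis1979, §I.3–I.4] -/
theorem coeff_toVector_eq_of_mem_orbit {G : Type*} [Group G] (K : Subgroup G) (T : heckeAlgebra k G K) {x y : G ⧸ K}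
    (h : y ∈ orbit K x) :
    (heckeAlgebra.toVector K T).coeff y = (heckeAlgebra.toVector K T).coeff x :=
  heckeAlgebra.coeff_eq_of_mem_orbit K (fun _ ha => heckeAlgebra.ofMulAction_toVector K T ha) h

end Summit.HodgeConjecture.HodgeConjecture.R90.S6

end
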